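import Literature.NumberTheory.Sieve.HeathBrownMorozClassLatticeCount
import HarnessLib

/-!
# Heath-Brown–Moroz 2004, Lemma 2.2/2.3: the class version of Heath-Brown's Lemma 5.1 (averaged over `R`)

Third brick of the class Type-I estimate for the class family `CubicSieve.classPairs` (crux `HeathBrownMorozUniform`
of `Summits/Parity`).  D. R. Heath-Brown and B. Z. Moroz, Proc. LMS (3) 88 (2004), §2: the Type-I level of
distribution of the coset sequence "as in [3, pp. 28–33]"; here the exact analogue of [HeathBrownActa2001, Lemma 5.1]
for `S_{d,γ}(R; X)` (`classLatticeCount`): for an admissible reduced class `(a, b) mod d`, `2 ≤ X`, `d ≤ X`,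
`0 < η ≤ 1`, `Q > 0`,
`∑_{Q<N(R)≤2Q, R∈𝒯r} τ(R)^A |S_{d,γ}(R; X) − [(d, N R) = 1]·η²X²/(d²N(R))| ≤ C (X + Q) log(Q+2)^c`
with `c, C` depending on `A` only (uniform in the class).  Proof = the tree's `lemma_5_1_bound_of_lemma_4_7_bound`
verbatim (the average over `R` of the double sum of [3, (5.2)]), fed with `abs_classLatticeCount_sub_le` for
`R` coprime to `d` and `classLatticeCount_eq_zero_of_not_coprime` otherwise.

## References

* D. R. Heath-Brown, B. Z. Moroz, Proc. LMS (3) 88 (2004), Lemmas 2.2–2.3. [cite: HeathBrownMoroz2004, Lemma 2.2]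
* D. R. Heath-Brown, Acta Math. 186 (2001), Lemma 5.1 and §5 pp. 28–30. [cite: HeathBrownActa2001, Lemma 5.1]

## Mathlib / tree search

Tree: everything used by `lemma_5_1_bound_of_lemma_4_7_bound` (`exists_sum_tr_pow_div_absNorm_le`,
`exists_sum_sigma_zero_pow_div_le_real`, `sum_filter_dvd_pow_le`, `idealDivisorCount_span_mul_θint_le`,
`sum_filter_ne_zero_natAbs_le`, `sum_sum_div_abs_le_of_lemma_4_7`, `rpow_le_inv_log_two_pow_mul`,
`intCoords_eq_zero`), `abs_classLatticeCount_sub_le`, `classLatticeCount_eq_zero_of_not_coprime`.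
-/

noncomputable section

open NumberField Finset Filter
open scoped Topology ArithmeticFunction.sigma

namespace Literature.NumberTheory.Sieve.CubicSieve

open LFunctions.CubeRootTwoField

set_option maxHeartbeats 1600000 in
open scoped Classical in
/-- **Heath-Brown's Lemma 5.1 for the class family** (HBM04 Lemmas 2.2–2.3 before the coprimality sieve):
for every `A ≥ 1` there are `c, C ≥ 0` such that for every admissible reduced class `(a, b) mod d` and all
`X ≥ max(2, d)`, `0 < η ≤ 1`, `Q > 0`,
`∑_{Q<N(R)≤2Q, R∈𝒯r} τ(R)^A |S_{d,γ}(R; X) − [(d, N R) = 1] η²X²/(d²N(R))| ≤ C (X + Q) log(Q + 2)^c`.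
[cite: HeathBrownMoroz2004, Lemma 2.2] [cite: HeathBrownActa2001, Lemma 5.1] -/
theorem class_lemma_5_1_bound_of_lemma_4_7_bound
    (h47 : ∀ A : ℕ, 0 < A → ∃ c C : ℝ, 0 ≤ c ∧ 0 ≤ C ∧ ∀ x y : ℝ, 2 ≤ x → 2 ≤ y →
      ∑ m ∈ (Icc (-⌊x⌋) ⌊x⌋).filter (· ≠ 0), ∑ n ∈ (Icc (-⌊y⌋) ⌊y⌋).filter (· ≠ 0),
        (idealDivisorCount (Ideal.span {((m : ℤ) : 𝓞 K) + ((n : ℤ) : 𝓞 K) * θint}) : ℝ) ^ A ≤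
      C * x * y * Real.log (x * y) ^ c)
    (A : ℕ) (_ : 0 < A) :
    ∃ c C : ℝ, 0 ≤ c ∧ 0 ≤ C ∧ ∀ d a b : ℕ, 0 < d → a < d → b < d → Nat.Coprime (a ^ 3 + 2 * b ^ 3) d →
      ∀ X η Q : ℝ, 2 ≤ X → (d : ℝ) ≤ X → 0 < η → η ≤ 1 → 0 < Q →
      ∑ R ∈ (idealsLE ⌊2 * Q⌋₊).filter (fun R => Q < (Ideal.absNorm R : ℝ) ∧
          (Ideal.absNorm R : ℝ) ≤ 2 * Q ∧ Squarefree (Ideal.absNorm R)),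
        (idealDivisorCount R : ℝ) ^ A * |(classLatticeCount X η d a b R : ℝ) -
          (if Nat.Coprime d (Ideal.absNorm R) then η ^ 2 * X ^ 2 / ((d : ℝ) ^ 2 * Ideal.absNorm R) else 0)| ≤
      C * (X + Q) * Real.log (Q + 2) ^ c := by
  classical
  obtain ⟨c₂, C₂, hc₂, hC₂, H47⟩ := h47 (A + 1) (Nat.succ_pos A)
  obtain ⟨k₁, D₁, hD₁, HE1⟩ := exists_sum_tr_pow_div_absNorm_le A
  obtain ⟨C₄, hC₄, H4div⟩ := exists_sum_sigma_zero_pow_div_le_real (12 * (A + 1))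
  obtain ⟨k₄, hk₄⟩ : ∃ k₄ : ℕ, k₄ = 2 ^ (12 * (A + 1) + 1) := ⟨_, rfl⟩
  rw [← hk₄] at H4div
  obtain ⟨T₀, hT₀⟩ : ∃ T₀ : ℝ, T₀ = (idealDivisorCount (Ideal.span {θint}) : ℝ) := ⟨_, rfl⟩
  have hT₀0 : 0 ≤ T₀ := by rw [hT₀]; exact Nat.cast_nonneg _
  set e₂ : ℝ := c₂ + 2 with he₂
  set cfin : ℝ := (k₁ : ℝ) + e₂ + k₄ with hcfin
  set M : ℝ := (Real.log 2)⁻¹ ^ cfin with hM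
  set K₁ : ℝ := 9 * D₁ with hK₁
  set K₂ : ℝ := 4 * (16 * C₂ * 4 ^ c₂ * (Real.log 2)⁻¹ ^ 2) with hK₂
  set K₃ : ℝ := 8 * T₀ ^ (A + 1) * C₄ with hK₃
  have hl2 : 0 < Real.log 2 := Real.log_pos one_lt_two
  have hk₁0 : (0 : ℝ) ≤ k₁ := Nat.cast_nonneg _
  have hk₄0 : (0 : ℝ) ≤ k₄ := Nat.cast_nonneg _
  have he₂0 : 0 ≤ e₂ := by rw [he₂]; linarith only [hc₂]
  have he₁c : (k₁ : ℝ) ≤ cfin := by rw [hcfin]; linarith only [he₂0, hk₄0]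
  have he₂c : e₂ ≤ cfin := by rw [hcfin]; linarith only [hk₁0, hk₄0]
  have he₃c : (k₄ : ℝ) ≤ cfin := by rw [hcfin]; linarith only [hk₁0, he₂0]
  have hK₁0 : 0 ≤ K₁ := by positivity
  have hK₂0 : 0 ≤ K₂ := by positivity
  have hK₃0 : 0 ≤ K₃ := by positivity
  refine ⟨cfin, (K₁ + K₂ + K₃) * M, by positivity, by positivity,
    fun d a b hd ha hb hadm X η Q hX2 hXd hη0 hη1 hQ => ?_⟩
  have hX : 1 ≤ X := by linarith only [hX2]
  set L : ℝ := Real.log (Q + 2) with hL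
  have hL2 : Real.log 2 ≤ L := Real.log_le_log two_pos (by linarith only [hQ])
  have hL0 : 0 < L := hl2.trans_le hL2
  have hX0 : 0 < X := by linarith only [hX]
  set q : ℕ := ⌊Q⌋₊ with hq
  have hqQ : (⌊Q⌋ : ℤ) = (q : ℤ) := (Int.natCast_floor_eq_floor hQ.le).symm
  have hqle : (q : ℝ) ≤ Q := Nat.floor_le hQ.le
  have hlogq : Real.log (q + 2) ≤ L := Real.log_le_log (by positivity) (by linarith only [hqle])
  have hlogq0 : 0 < Real.log (q + 2) := hl2.trans_le (Real.log_le_log two_pos (by linarith only [(q.cast_nonneg : (0:ℝ) ≤ q)]))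
  have hmain := HE1 Q hQ
  set tr := (idealsLE ⌊2 * Q⌋₊).filter (fun R => Q < (Ideal.absNorm R : ℝ) ∧
    (Ideal.absNorm R : ℝ) ≤ 2 * Q ∧ Squarefree (Ideal.absNorm R)) with htr
  clear_value tr
  set Fq : Finset ℤ := (Icc (-(q : ℤ)) q).filter (· ≠ 0) with hFq
  set Iq : Finset ℤ := Icc (-(q : ℤ)) q with hIq
  set W : ℤ → ℝ := fun s => min (2 * X) (2 * Q / |(s : ℝ)|) with hW
  set W' : ℤ → ℝ := fun t => if t = 0 then 2 * X else min (2 * X) (2 * Q / |(t : ℝ)|) with hW'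
  set J : ℤ → ℤ → Ideal (𝓞 K) := fun s t => Ideal.span {(t : 𝓞 K) - (s : 𝓞 K) * θint} with hJ
  have hW0 : ∀ s, 0 ≤ W s := fun s => le_min (by linarith only [hX0]) (by positivity)
  have hW'0 : ∀ t, 0 ≤ W' t := fun t => by
    simp only [hW']; split_ifs
    · linarith only [hX0]
    · exact le_min (by linarith only [hX0]) (by positivity)
  have hWle : ∀ s : ℤ, s ≠ 0 → W s ≤ 2 * Q / |(s : ℝ)| := fun s _ => min_le_right _ _
  -- Step 1: the bound for each `R`
  have hstep1 : ∀ R ∈ tr, (idealDivisorCount R : ℝ) ^ A *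
      |(classLatticeCount X η d a b R : ℝ) -
        (if Nat.Coprime d (Ideal.absNorm R) then η ^ 2 * X ^ 2 / ((d : ℝ) ^ 2 * Ideal.absNorm R) else 0)| ≤
      (idealDivisorCount R : ℝ) ^ A * (9 * X / Ideal.absNorm R +
        Q⁻¹ * ∑ s ∈ Fq, ∑ t ∈ Iq, (if R ∣ J s t then (1 : ℝ) else 0) * (W s * W' t)) := by
    intro R hR
    rw [htr, mem_filter] at hR
    obtain ⟨-, hQR, hR2, hsq⟩ := hR
    refine mul_le_mul_of_nonneg_left ?_ (by positivity)
    by_cases hcop : Nat.Coprime d (Ideal.absNorm R)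
    · rw [if_pos hcop]
      have h := abs_classLatticeCount_sub_le hsq hd ha hb hcop hXd hX2 hη0 hη1 hQR hR2
      rw [hqQ] at h
      exact h
    · rw [if_neg hcop, classLatticeCount_eq_zero_of_not_coprime hadm
        (fun h => hcop (Nat.Coprime.symm h)), Nat.cast_zero, sub_zero, abs_zero]
      have hNpos : (0 : ℝ) < Ideal.absNorm R := lt_trans hQ hQR
      have h1 : 0 ≤ 9 * X / (Ideal.absNorm R : ℝ) := by positivity
      have h2 : 0 ≤ Q⁻¹ * ∑ s ∈ Fq, ∑ t ∈ Iq, (if R ∣ J s t then (1 : ℝ) else 0) * (W s * W' t) :=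
        mul_nonneg (by positivity) (sum_nonneg fun s _ => sum_nonneg fun t _ =>
          mul_nonneg (by split_ifs <;> norm_num) (mul_nonneg (hW0 s) (hW'0 t)))
      linarith
  -- Step 2: sum over `R` and interchange
  have hswap : ∀ R ∈ tr, (idealDivisorCount R : ℝ) ^ A *
      (Q⁻¹ * ∑ s ∈ Fq, ∑ t ∈ Iq, (if R ∣ J s t then (1 : ℝ) else 0) * (W s * W' t)) =
      Q⁻¹ * ∑ s ∈ Fq, ∑ t ∈ Iq, W s * W' t *
        (if R ∣ J s t then (idealDivisorCount R : ℝ) ^ A else 0) := by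
    intro R _
    simp only [mul_sum]
    refine sum_congr rfl fun s _ => sum_congr rfl fun t _ => ?_
    split_ifs <;> ring
  have hstep2 : ∑ R ∈ tr, (idealDivisorCount R : ℝ) ^ A * (9 * X / Ideal.absNorm R +
        Q⁻¹ * ∑ s ∈ Fq, ∑ t ∈ Iq, (if R ∣ J s t then (1 : ℝ) else 0) * (W s * W' t)) =
      9 * X * ∑ R ∈ tr, (idealDivisorCount R : ℝ) ^ A / Ideal.absNorm R +
        Q⁻¹ * ∑ s ∈ Fq, ∑ t ∈ Iq, W s * W' t *
          ∑ R ∈ tr.filter (· ∣ J s t), (idealDivisorCount R : ℝ) ^ A := by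
    have hre : ∑ R ∈ tr, (idealDivisorCount R : ℝ) ^ A * (9 * X / Ideal.absNorm R +
        Q⁻¹ * ∑ s ∈ Fq, ∑ t ∈ Iq, (if R ∣ J s t then (1 : ℝ) else 0) * (W s * W' t)) =
        ∑ R ∈ tr, (9 * X * ((idealDivisorCount R : ℝ) ^ A / Ideal.absNorm R) +
          Q⁻¹ * ∑ s ∈ Fq, ∑ t ∈ Iq, W s * W' t *
            (if R ∣ J s t then (idealDivisorCount R : ℝ) ^ A else 0)) :=
      sum_congr rfl fun R hR => by rw [mul_add, hswap R hR]; ring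
    rw [hre, sum_add_distrib, ← mul_sum, ← mul_sum]
    congr 1
    congr 1
    rw [sum_comm]
    refine sum_congr rfl fun s _ => ?_
    rw [sum_comm]
    refine sum_congr rfl fun t _ => ?_
    rw [← mul_sum, sum_filter]
  -- Step 3: the divisor bound `∑_{R ∣ J} τ(R)^A ≤ τ(J)^{A+1}`
  have hJ0 : ∀ s t : ℤ, s ≠ 0 → J s t ≠ ⊥ := by
    intro s t hs h0
    rw [hJ, Ideal.span_singleton_eq_bot] at h0
    have h1 := congr_arg (algebraMap (𝓞 K) K) h0
    simp only [map_sub, map_mul, map_intCast, map_zero, show algebraMap (𝓞 K) K θint = θ from rfl] at h1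
    have h2 : ((t : ℤ) : K) + ((-s : ℤ) : K) * θ + ((0 : ℤ) : K) * θ ^ 2 = 0 := by
      push_cast; linear_combination h1
    exact hs (neg_eq_zero.mp (intCoords_eq_zero h2).2.1)
  have hstep3 : ∀ s ∈ Fq, ∀ t ∈ Iq, W s * W' t * ∑ R ∈ tr.filter (· ∣ J s t), (idealDivisorCount R : ℝ) ^ A ≤
      W s * W' t * (idealDivisorCount (J s t) : ℝ) ^ (A + 1) := by
    intro s hs t _
    have hs0 : s ≠ 0 := (mem_filter.mp hs).2
    exact mul_le_mul_of_nonneg_left (sum_filter_dvd_pow_le tr (hJ0 s t hs0) A)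
      (mul_nonneg (hW0 s) (hW'0 t))
  -- Step 4: split `t = 0` / `t ≠ 0`
  have h0mem : (0 : ℤ) ∈ Iq := by rw [hIq, mem_Icc]; omega
  have hW'zero : W' 0 = 2 * X := by simp [hW']
  have hsplit : ∀ s : ℤ, ∑ t ∈ Iq, W s * W' t * (idealDivisorCount (J s t) : ℝ) ^ (A + 1) =
      W s * (2 * X) * (idealDivisorCount (J s 0) : ℝ) ^ (A + 1) +
        ∑ t ∈ Fq, W s * W' t * (idealDivisorCount (J s t) : ℝ) ^ (A + 1) := by
    intro s
    rw [hFq, Finset.filter_ne', ← Finset.sum_erase_add _ _ h0mem, hW'zero, add_comm]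
  -- the `t = 0` terms
  have ht0 : ∑ s ∈ Fq, W s * (2 * X) * (idealDivisorCount (J s 0) : ℝ) ^ (A + 1) ≤
      8 * T₀ ^ (A + 1) * C₄ * Q * X * L ^ (k₄ : ℝ) := by
    have hterm : ∀ s ∈ Fq, W s * (2 * X) * (idealDivisorCount (J s 0) : ℝ) ^ (A + 1) ≤
        4 * Q * X * T₀ ^ (A + 1) * ((σ 0 s.natAbs : ℝ) ^ (12 * (A + 1)) / s.natAbs) := by
      intro s hs
      have hs0 : s ≠ 0 := (mem_filter.mp hs).2
      have hsabs : (0 : ℝ) < |(s : ℝ)| := abs_pos.mpr (by exact_mod_cast hs0)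
      have hτ : (idealDivisorCount (J s 0) : ℝ) ≤ T₀ * (σ 0 s.natAbs : ℝ) ^ 12 := by
        have h := idealDivisorCount_span_mul_θint_le hs0
        have : J s 0 = Ideal.span {((0 : ℤ) : 𝓞 K) - (s : 𝓞 K) * θint} := by simp [hJ]
        rw [this, hT₀]; exact_mod_cast h
      have hnat : (s.natAbs : ℝ) = |(s : ℝ)| := by rw [Nat.cast_natAbs, Int.cast_abs]
      have a1 : W s * (2 * X) ≤ 2 * Q / |(s : ℝ)| * (2 * X) :=
        mul_le_mul_of_nonneg_right (hWle s hs0) (by linarith only [hX0])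
      have a2 : (idealDivisorCount (J s 0) : ℝ) ^ (A + 1) ≤ (T₀ * (σ 0 s.natAbs : ℝ) ^ 12) ^ (A + 1) :=
        pow_le_pow_left₀ (Nat.cast_nonneg _) hτ _
      have a0 : 0 ≤ W s * (2 * X) := mul_nonneg (hW0 s) (by linarith only [hX0])
      have a3 := mul_le_mul a1 a2 (by positivity) (a0.trans a1)
      refine a3.trans (le_of_eq ?_)
      rw [hnat, mul_pow, ← pow_mul]
      field_simp
      ring
    refine (sum_le_sum hterm).trans ?_
    rw [← mul_sum]
    have hfold : ∑ s ∈ Fq, (σ 0 s.natAbs : ℝ) ^ (12 * (A + 1)) / s.natAbs ≤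
        2 * ∑ d ∈ Icc 1 q, (σ 0 d : ℝ) ^ (12 * (A + 1)) / d :=
      sum_filter_ne_zero_natAbs_le q (fun d => (σ 0 d : ℝ) ^ (12 * (A + 1)) / d)
    have hdiv : ∑ d ∈ Icc 1 q, (σ 0 d : ℝ) ^ (12 * (A + 1)) / d ≤ C₄ * L ^ (k₄ : ℝ) := by
      have hsub : Icc 1 q ⊆ Icc 1 ⌊(q : ℝ) + 2⌋₊ := by
        intro d hd; rw [mem_Icc] at hd ⊢
        refine ⟨hd.1, hd.2.trans (Nat.le_floor ?_)⟩; linarith only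
      calc ∑ d ∈ Icc 1 q, (σ 0 d : ℝ) ^ (12 * (A + 1)) / d
          ≤ ∑ d ∈ Icc 1 ⌊(q : ℝ) + 2⌋₊, (σ 0 d : ℝ) ^ (12 * (A + 1)) / d :=
            sum_le_sum_of_subset_of_nonneg hsub fun d _ _ => by positivity
        _ ≤ C₄ * Real.log ((q : ℝ) + 2) ^ k₄ := H4div _ (by linarith only [(q.cast_nonneg : (0:ℝ) ≤ q)])
        _ ≤ C₄ * L ^ (k₄ : ℝ) := by
            rw [Real.rpow_natCast]
            exact mul_le_mul_of_nonneg_left (pow_le_pow_left₀ hlogq0.le hlogq k₄) hC₄.le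
    calc 4 * Q * X * T₀ ^ (A + 1) * ∑ s ∈ Fq, (σ 0 s.natAbs : ℝ) ^ (12 * (A + 1)) / s.natAbs
        ≤ 4 * Q * X * T₀ ^ (A + 1) * (2 * (C₄ * L ^ (k₄ : ℝ))) := by
          refine mul_le_mul_of_nonneg_left (hfold.trans ?_) (by positivity)
          linarith only [hdiv]
      _ = 8 * T₀ ^ (A + 1) * C₄ * Q * X * L ^ (k₄ : ℝ) := by ring
  -- the `t ≠ 0` terms
  have ht1 : ∑ s ∈ Fq, ∑ t ∈ Fq, W s * W' t * (idealDivisorCount (J s t) : ℝ) ^ (A + 1) ≤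
      4 * Q ^ 2 * (16 * C₂ * 4 ^ c₂ * (Real.log 2)⁻¹ ^ 2) * L ^ e₂ := by
    have hterm : ∀ s ∈ Fq, ∀ t ∈ Fq, W s * W' t * (idealDivisorCount (J s t) : ℝ) ^ (A + 1) ≤
        4 * Q ^ 2 * ((idealDivisorCount (J s t) : ℝ) ^ (A + 1) / (|(s : ℝ)| * |(t : ℝ)|)) := by
      intro s hs t ht
      have hs0 : s ≠ 0 := (mem_filter.mp hs).2
      have ht0 : t ≠ 0 := (mem_filter.mp ht).2
      have hsabs : (0 : ℝ) < |(s : ℝ)| := abs_pos.mpr (by exact_mod_cast hs0)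
      have htabs : (0 : ℝ) < |(t : ℝ)| := abs_pos.mpr (by exact_mod_cast ht0)
      have hW't : W' t ≤ 2 * Q / |(t : ℝ)| := by
        show (if t = 0 then 2 * X else min (2 * X) (2 * Q / |(t : ℝ)|)) ≤ _
        rw [if_neg ht0]; exact min_le_right _ _
      have hQs : 0 ≤ 2 * Q / |(s : ℝ)| := by positivity
      calc W s * W' t * (idealDivisorCount (J s t) : ℝ) ^ (A + 1)
          ≤ (2 * Q / |(s : ℝ)|) * (2 * Q / |(t : ℝ)|) * (idealDivisorCount (J s t) : ℝ) ^ (A + 1) :=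
            mul_le_mul_of_nonneg_right (mul_le_mul (hWle s hs0) hW't (hW'0 t) hQs) (by positivity)
        _ = 4 * Q ^ 2 * ((idealDivisorCount (J s t) : ℝ) ^ (A + 1) / (|(s : ℝ)| * |(t : ℝ)|)) := by
            rw [div_mul_div_comm, show 2 * Q * (2 * Q) = 4 * Q ^ 2 by ring, div_mul_eq_mul_div,
              mul_div_assoc]
    calc ∑ s ∈ Fq, ∑ t ∈ Fq, W s * W' t * (idealDivisorCount (J s t) : ℝ) ^ (A + 1)
        ≤ ∑ s ∈ Fq, ∑ t ∈ Fq, 4 * Q ^ 2 * ((idealDivisorCount (J s t) : ℝ) ^ (A + 1) / (|(s : ℝ)| * |(t : ℝ)|)) :=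
          sum_le_sum fun s hs => sum_le_sum fun t ht => hterm s hs t ht
      _ = 4 * Q ^ 2 * ∑ s ∈ Fq, ∑ t ∈ Fq, (idealDivisorCount (J s t) : ℝ) ^ (A + 1) / (|(s : ℝ)| * |(t : ℝ)|) := by
          rw [mul_sum]; refine sum_congr rfl fun s _ => ?_; rw [mul_sum]
      _ ≤ 4 * Q ^ 2 * (16 * C₂ * 4 ^ c₂ * (Real.log 2)⁻¹ ^ 2 * Real.log (q + 2) ^ (c₂ + 2)) :=
          mul_le_mul_of_nonneg_left (sum_sum_div_abs_le_of_lemma_4_7 hc₂ hC₂ H47 q) (by positivity)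
      _ ≤ 4 * Q ^ 2 * (16 * C₂ * 4 ^ c₂ * (Real.log 2)⁻¹ ^ 2 * L ^ e₂) := by
          refine mul_le_mul_of_nonneg_left (mul_le_mul_of_nonneg_left ?_ (by positivity)) (by positivity)
          rw [he₂]; exact Real.rpow_le_rpow hlogq0.le hlogq he₂0
      _ = _ := by ring
  -- Step 5: combine
  have hpow : ∀ {e : ℝ}, 0 ≤ e → e ≤ cfin → L ^ e ≤ M * L ^ cfin := fun he hec =>
    rpow_le_inv_log_two_pow_mul hL2 he hec
  have hP0 : 0 ≤ X + Q := by linarith only [hX0, hQ]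
  calc ∑ R ∈ tr, (idealDivisorCount R : ℝ) ^ A * |(classLatticeCount X η d a b R : ℝ) -
          (if Nat.Coprime d (Ideal.absNorm R) then η ^ 2 * X ^ 2 / ((d : ℝ) ^ 2 * Ideal.absNorm R) else 0)|
      ≤ ∑ R ∈ tr, (idealDivisorCount R : ℝ) ^ A * (9 * X / Ideal.absNorm R +
          Q⁻¹ * ∑ s ∈ Fq, ∑ t ∈ Iq, (if R ∣ J s t then (1 : ℝ) else 0) * (W s * W' t)) :=
        sum_le_sum hstep1
    _ = _ := hstep2
    _ ≤ 9 * X * (D₁ * L ^ (k₁ : ℝ)) + Q⁻¹ * ∑ s ∈ Fq, (W s * (2 * X) * (idealDivisorCount (J s 0) : ℝ) ^ (A + 1) +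
          ∑ t ∈ Fq, W s * W' t * (idealDivisorCount (J s t) : ℝ) ^ (A + 1)) := by
        refine add_le_add ?_ ?_
        · refine mul_le_mul_of_nonneg_left ?_ (by positivity)
          rw [Real.rpow_natCast]; exact hmain
        · refine mul_le_mul_of_nonneg_left (sum_le_sum fun s hs => ?_) (by positivity)
          rw [← hsplit s]
          exact sum_le_sum fun t ht => hstep3 s hs t ht
    _ = 9 * D₁ * X * L ^ (k₁ : ℝ) + Q⁻¹ * (∑ s ∈ Fq, W s * (2 * X) * (idealDivisorCount (J s 0) : ℝ) ^ (A + 1) +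
          ∑ s ∈ Fq, ∑ t ∈ Fq, W s * W' t * (idealDivisorCount (J s t) : ℝ) ^ (A + 1)) := by
        rw [sum_add_distrib]; ring
    _ ≤ 9 * D₁ * X * L ^ (k₁ : ℝ) + Q⁻¹ * (8 * T₀ ^ (A + 1) * C₄ * Q * X * L ^ (k₄ : ℝ) +
          4 * Q ^ 2 * (16 * C₂ * 4 ^ c₂ * (Real.log 2)⁻¹ ^ 2) * L ^ e₂) :=
        add_le_add le_rfl (mul_le_mul_of_nonneg_left (add_le_add ht0 ht1) (by positivity))
    _ = K₁ * X * L ^ (k₁ : ℝ) + K₃ * X * L ^ (k₄ : ℝ) + K₂ * Q * L ^ e₂ := by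
        rw [hK₁, hK₂, hK₃]; field_simp; ring
    _ ≤ K₁ * X * (M * L ^ cfin) + K₃ * X * (M * L ^ cfin) + K₂ * Q * (M * L ^ cfin) := by
        refine add_le_add (add_le_add ?_ ?_) ?_
        · exact mul_le_mul_of_nonneg_left (hpow hk₁0 he₁c) (by positivity)
        · exact mul_le_mul_of_nonneg_left (hpow hk₄0 he₃c) (by positivity)
        · exact mul_le_mul_of_nonneg_left (hpow he₂0 he₂c) (by positivity)
    _ ≤ (K₁ + K₂ + K₃) * M * (X + Q) * L ^ cfin := by
        have hLc : 0 ≤ M * L ^ cfin := by positivity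
        have h1 : K₁ * X ≤ K₁ * (X + Q) := mul_le_mul_of_nonneg_left (by linarith only [hQ]) hK₁0
        have h2 : K₃ * X ≤ K₃ * (X + Q) := mul_le_mul_of_nonneg_left (by linarith only [hQ]) hK₃0
        have h3 : K₂ * Q ≤ K₂ * (X + Q) := mul_le_mul_of_nonneg_left (by linarith only [hX0]) hK₂0
        calc K₁ * X * (M * L ^ cfin) + K₃ * X * (M * L ^ cfin) + K₂ * Q * (M * L ^ cfin)
            = (K₁ * X + K₃ * X + K₂ * Q) * (M * L ^ cfin) := by ring
          _ ≤ ((K₁ + K₂ + K₃) * (X + Q)) * (M * L ^ cfin) :=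
              mul_le_mul_of_nonneg_right (by linarith only [h1, h2, h3]) hLc
          _ = _ := by ring

end Literature.NumberTheory.Sieve.CubicSieve

end
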